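import Literature.AlgebraicGeometry.Hyperkaehler.KummerTypeHodgeSimilitudes
import Literature.AlgebraicGeometry.Hyperkaehler.KummerTypeIntermediateJacobian
import Literature.AlgebraicGeometry.HodgeTheory.DominatedByPowersHodgeConjecture
import HarnessLib
import HarnessLib.Audit

/-!
# OpenQuestionsFloccariVaresco — the questions Floccari–Varesco (Math. Ann. 2024/25) leave open for varieties of `Kumⁿ`-type, as typed CONJECTURES (obligations of `HodgeConjecture/HodgeConjecture`; nothing asserted)

HONEST FRAMING: typed ≠ proved ≠ endorsed.  Nothing in this file asserts `HodgeConjecture`, `HC_AV`,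
`W₆`, `HC_Kum4Type` or any of the statements below; every `def … : Prop` here is an OPEN STATEMENT the
cited authors leave open (with its printed status), typed in the tree's vocabulary so that the
plan-novel ∕ lens seats (`oqh`, `transfer`) and the ladder rungs H3 ("HC for all projective HK of
`Kumⁿ`-type, `n ≥ 4`") ∕ H3-outlook (`n ≥ 5`) of LADDER-HodgeAV can consume STATEMENTS instead of prose.
Cross-ladder literature-typing layer D-0088(4), tranche LT-H4 (open-question harvest), seat
`hodge-lit-oqh-2`; conjecture LEAF (nothing but `@[conjecture]` definitions; imports `Literature.*` /
`HarnessLib` only), so that Literature and route files may import it.  Kernel glue relating these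
statements to the typed rung `Summit.HodgeConjecture.CorCM.Stage4.HC_KummerType`, to
`Summit.Ventures.HodgeKum4.HC_Kum4TypePowers` and to Arapura's named fact lives in the sibling
`Theorems/OpenQuestionsFloccariVarescoGlue.lean`.

## Source of record and what it leaves open (read at source; locators = materialised arXiv text)

S. Floccari, M. Varesco, *Algebraic cycles on hyper-Kähler varieties of generalized Kummer type*,
Math. Ann. 391 (2025) (arXiv:2308.04865) [`FloccariVaresco2024`; REFEREED]:
* §1, after Thm. 1.1 [corpus:paper-arxiv-2308.04865 p0003:L21–L24], verbatim: "For `j ≤ n`, cup-product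
  induces an isomorphism `A₂^{2j}(X) ≅ Symʲ(H²(X,ℚ))` of Hodge structures, by a theorem of Verbitsky.
  However, Theorem 1.1 is not sufficient to prove the Hodge conjecture for `X` (see [GKLR]).  For
  `n = 3`, the full Hodge conjecture proven in [Floccari 2023] is a stronger result and requires
  considerably more work. For `n = 2`, […] Hassett and Tschinkel have shown […]."  ⇒ OPEN: the Hodge
  conjecture for projective `Kumⁿ`-type, `n ≥ 4`, outside the subalgebra generated by `H²` — ALREADY
  TYPED as `Summit.HodgeConjecture.CorCM.Stage4.HC_KummerType` (all `n ≥ 2`) and, for `n = 4`, as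
  `Summit.Ventures.HodgeKum4.HC_Kum4Type`; NOT re-typed here.
* §2 Remark 2.2 [p0005:L17–L18], verbatim: "Let `X` be a smooth and projective variety. Then the Hodge
  conjecture holds for `X` and all of its powers if and only if the restriction of `R` to `⟨𝔥(X)⟩_Mot`
  is full." and §4 Remark 4.4 [p0008:L16–L18]: "consider any power `Z = Xʳ`. […] all Hodge classes in
  `A₂•(Z)` are algebraic" (a THEOREM, tree record
  `Hyperkaehler.FloccariVaresco2024_degreeTwoGenerated_hodgeClasses_algebraic_powers`).  ⇒ OPEN: the Hodge
  conjecture for the POWERS `Xʳ` of a projective `Kumⁿ`-variety outside `A₂•(Xʳ)` — `HC_KummerTypePowers`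
  below (`n = 4`: `Summit.Ventures.HodgeKum4.HC_Kum4TypePowers`, by name in the glue file).
* §1 [p0003:L19], verbatim: "Our proof leads to the suggestive expectation that any variety of
  `Kumⁿ`-type is naturally associated with a K3 surface, generalizing the construction given in
  [Floccari 2024] for the six-dimensional case."  STATUS: now a THEOREM in print — S. Floccari,
  Geom. Topol. 30 (2026) 1129–1154, Thms. 1.1–1.2 [`Floccari2026`; REFEREED] (the K3 surface `S_X` of any
  `Kumⁿ`-variety; not typable today: moduli of sheaves on K3 surfaces are absent from the tree) — hence
  NOT typed as a conjecture.  Its MOTIVIC strengthening is the open statement of the 2026 sequel: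
  S. Floccari, L. Fu, *The hyper-Kummer construction* (arXiv:2607.07528, July 2026)
  [`FloccariFu2026HyperKummer`; PREPRINT], **Conjecture 1.4** [corpus:paper-arxiv-2607.07528 p0013:L25–L27],
  verbatim: "Let `X` be a projective hyper-Kähler variety, and let `KS(X)` be the associated Kuga–Satake
  abelian variety. Then `X` is motivated by `KS(X)`, i.e., the motive of `X` belongs to the thick tensor
  subcategory of motives generated by the motive of `KS(X)`."; Theorem K (= Thm. 13.2, Cors. 13.4, 13.10)
  [p0013:L35–p0014:L9]: for "(ii) any variety of `Kum²` or `Kum³`-type […] the Kuga–Satake variety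
  `KS(X)` of `X` is isogenous to a power of an abelian fourfold of Weil type with discriminant `1`, and
  Conjecture 1.4 holds for the homological motive of `X`. Moreover, the Hodge conjecture and the Tate
  conjecture hold for `X` and any of its powers."  No statement for `Kumⁿ`, `n ≥ 4` (bib note of
  `FloccariFu2026HyperKummer`; OPEN-IN-PRINT watch of cell `hodge-kum4`, 2026-08-25).  For `Kumⁿ`-type,
  `KS(X,L)` is isogenous to `J³(X)⁴` (O'Grady 2021 Thm. 1.5 [`OGrady2021KummerTori`; REFEREED], last
  sentence) and `J³(X)` is a discriminant-1 Weil fourfold all of whose powers satisfy the Hodge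
  conjecture (Floccari 2026 Thm. 1.3; tree: `Markman2023_thirdCohomology_kummerType_discOneWeilFourfold` +
  `hodgeConjectureFor_powers_thirdJacobian`).  ⇒ OPEN (`n ≥ 4`; PREPRINT theorem for `n = 2, 3`):
  `KummerType_dominatedByFourfoldPowers` below — the cohomological shadow "dominated by the powers of an
  abelian fourfold whose powers satisfy HC" of Conjecture 1.4 for `Kumⁿ`, in EXACTLY the shape the
  `Kum⁴` cell already uses (`Summit.Ventures.HodgeKum4.GammaInvariantsDominatedKum4`,
  `exists_isDominatedByPowers_kum4Type`: "Floccari–Fu Conj. 1.4 shadow for `Kum⁴`").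
* Floccari–Varesco Cor. 1.3 / proof [p0008:L25–L27]: "the Tate conjecture for `X/k` is equivalent to the
  Hodge conjecture for `X_ℂ`" (Mumford–Tate conjecture known for HK of known deformation type) — the
  Tate side of every statement here is therefore equivalent in print and NOT typed (no étale carriers
  needed by the consumers).

## Which rung ∕ route each statement feeds (LADDER-HodgeAV)

* `HC_KummerTypePowers` → rung H3 (`n = 4`: it IS `HC_Kum4TypePowers` up to the kernel identification in
  the glue file) and the H3 outlook `n ≥ 5`; `oqh` lens.
* `KummerType_dominatedByFourfoldPowers` → rung H3 ∕ outlook `n ≥ 5` through Arapura 2006 Lemma 4.2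
  (tree fact `Arapura2006_hodgeClasses_algebraic_of_isDominatedByPowers`): kernel glue
  `hc_kummerType_of_dominated : Arapura → this → HC_KummerType ∧ HC_KummerTypePowers` (glue file);
  `transfer` lens (the fourfold is O'Grady's torus `J³(X)`: transfer abelian fourfold ⇝ HK `2n`-fold).

Grades: every cited status line carries REFEREED ∕ PREPRINT; this file's statements are OURS (typed
conjectures), stated nowhere as theorems.
-/

noncomputable section

open Literature.AlgebraicGeometry Literature.AlgebraicGeometry.Motives
  Literature.AlgebraicGeometry.HodgeTheory Literature.AlgebraicGeometry.Hyperkaehler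

-- `Summit.<Summit>.<Problem>` is the mandated summit-side namespace (CONVENTIONS §2); for the
-- single-conjunct summit `HodgeConjecture` the two coincide, so the duplicate is deliberate.
set_option linter.dupNamespace false

namespace Summit.HodgeConjecture.HodgeConjecture.Theorems

/-- OPEN — **the Hodge conjecture for every POWER of every projective variety of `Kumⁿ`-type.**  For
`2 ≤ n`, `X` smooth projective of dimension `2n` of `Kumⁿ`-type (`Hyperkaehler.IsOfGeneralizedKummerType`)
and every `m`, the tree's per-variety Hodge statement for the cartesian power `X^{m+1}`
(`Motives.SchemeOver.pow`, dimension `(m + 1) * (2 * n)`) — the spelling of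
`Summit.Ventures.HodgeKum4.HC_Kum4TypePowers` for all `n`.  Framed by Floccari–Varesco Rem. 2.2 ("the
Hodge conjecture holds for `X` and all of its powers if and only if the restriction of `R` to `⟨𝔥(X)⟩_Mot`
is full") and Rem. 4.4 (the part in the subalgebra generated by `H²(Xʳ)` is PROVED, all `n`, all `r` —
tree record `FloccariVaresco2024_degreeTwoGenerated_hodgeClasses_algebraic_powers`).  STATUS: `m = 0` is
the typed rung `Stage4.HC_KummerType` (THEOREM in print for `n = 2` — REFEREED, Floccari–Varesco Math.
Ann. Cor. 1.2 — and for `n = 3` — PREPRINT, Floccari arXiv:2308.02267 (2023) Thm. 1.1, still cited as an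
arXiv preprint by Floccari–Fu 2026 and Floccari, Geom. Topol. 2026; OPEN for `n ≥ 4`, Floccari–Varesco §1:
"Theorem 1.1 is not sufficient to prove the Hodge conjecture for `X`"); all powers, `n = 2, 3`: PREPRINT
theorem (Floccari–Fu 2026, *The hyper-Kummer construction*, Thm. K (ii) / Cor. 13.4: "the Hodge conjecture
and the Tate conjecture hold for `X` and any of its powers") — in the tree a THEOREM modulo named facts,
`Hyperkaehler.FloccariFu2026_kum2Kum3Type_isDominatedByPowers_discOneWeilFourfold.hodgeConjectureFor_powers`
(file `Hyperkaehler/KummerTypeDominatedByWeilFourfoldPowers`); `n ≥ 4`: OPEN, no statement in print.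
Never asserted; an explicit hypothesis wherever used.
[cite: FloccariVaresco2024, Rem. 2.2 (§2) and Rem. 4.4 (§4); §1 after Thm. 1.1 ("not sufficient")]
[cite: FloccariFu2026HyperKummer, Thm. K (ii) = Thm. 13.2 / Cor. 13.4 (arXiv:2607.07528 pp. 13–14; PREPRINT)] -/
@[conjecture] def HC_KummerTypePowers : Prop :=
  ∀ (n : ℕ), 2 ≤ n → ∀ ⦃X : SchemeOver ℂ⦄, IsSmoothProjective (2 * n) X → IsOfGeneralizedKummerType n X →
    ∀ m : ℕ, HodgeConjectureFor ((m + 1) * (2 * n)) (X.pow (m + 1))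

/-- OPEN (for `n ≥ 4`; PREPRINT theorem for `n = 2, 3`) — **every projective variety of `Kumⁿ`-type is
cohomologically dominated by the powers of a smooth projective FOURFOLD all of whose powers satisfy the
Hodge conjecture** (intended fourfold: O'Grady's intermediate Jacobian `J³(X)`, a discriminant-1 Weil
abelian fourfold with `KS(X,L) ~ J³(X)⁴`, O'Grady 2021 Thm. 1.5, whose powers satisfy HC by Floccari 2026
Thm. 1.3 — tree: `Markman2023_thirdCohomology_kummerType_discOneWeilFourfold.hodgeConjectureFor_powers_thirdJacobian`).
For `2 ≤ n` and `X` smooth projective of dimension `2n` of `Kumⁿ`-type: there is a smooth projective `B`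
of dimension `4` with `HodgeConjectureFor ((m+1)·4) (B^{m+1})` for all `m` and
`HodgeTheory.IsDominatedByPowers (2 * n) X 4 B` (every `Hᵏ(X(ℂ); ℂ)` is spanned by images of algebraic
correspondences from powers `Bᵉ`; Arapura 2006 Lemma 1.1 form).  This is the cohomological SHADOW, for
`Kumⁿ`, of Floccari–Fu 2026 **Conjecture 1.4** ("Let `X` be a projective hyper-Kähler variety, and let
`KS(X)` be the associated Kuga–Satake abelian variety. Then `X` is motivated by `KS(X)`, i.e., the motive
of `X` belongs to the thick tensor subcategory of motives generated by the motive of `KS(X)`" — which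
IMPLIES domination by powers of `KS(X)`, hence of `J³(X)`), in exactly the shape of the `Kum⁴` cell's
`Summit.Ventures.HodgeKum4.GammaInvariantsDominatedKum4` ∕ `exists_isDominatedByPowers_kum4Type`
("Floccari–Fu Conj. 1.4 shadow for `Kum⁴`"), now for all `n`.  STATUS: `n = 2, 3` — Floccari–Fu 2026
Thm. K (ii) (PREPRINT): "`KS(X)` […] is isogenous to a power of an abelian fourfold of Weil type with
discriminant `1`, and Conjecture 1.4 holds for the homological motive of `X`"; `n = 4` — the conditional
kernel target of cell `hodge-kum4`; `n ≥ 5` — OPEN, no statement in print.  Grade of the specialisation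
`KS(X) ⇝ J³(X)`: PRINT-SYNTHESIS (O'Grady 2021 Thm. 1.5 + Floccari 2026 Thm. 1.3, both REFEREED).  In the tree
the instance `n = 2, 3` is a THEOREM modulo named facts:
`Hyperkaehler.FloccariFu2026_kum2Kum3Type_isDominatedByPowers_discOneWeilFourfold.exists_fourfold_powers`
(PREPRINT source).  Never asserted; with Arapura 2006 Lemma 4.2 it implies `HC_KummerType` and
`HC_KummerTypePowers` (glue file).
[cite: FloccariFu2026HyperKummer, Conj. 1.4 and Thm. K (ii) (arXiv:2607.07528 pp. 13–14; PREPRINT)]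
[cite: OGrady2021KummerTori, Thm. 1.5 (KS(X,L) isogenous to J³(X)⁴)]
[cite: FloccariVaresco2024, Rem. 2.2 (§2) and §1 ("suggestive expectation")]
[cite: Arapura2006, §1 Lemma 1.1 (domination ⟹ motivated)] -/
@[conjecture] def KummerType_dominatedByFourfoldPowers : Prop :=
  ∀ (n : ℕ), 2 ≤ n → ∀ ⦃X : SchemeOver ℂ⦄, IsSmoothProjective (2 * n) X → IsOfGeneralizedKummerType n X →
    ∃ B : SchemeOver ℂ, IsSmoothProjective 4 B ∧
      (∀ m : ℕ, HodgeConjectureFor ((m + 1) * 4) (B.pow (m + 1))) ∧ IsDominatedByPowers (2 * n) X 4 B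

end Summit.HodgeConjecture.HodgeConjecture.Theorems

end
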